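import Summits.ABC.ABC.Theorems.IsogenyGlueCongruenceEllipticGluingPrimeBoundOfSimpleShared
import Summits.ABC.ABC.Theorems.IsogenyGlueCongruenceEllipticGluingPrimeBoundSlicesOfBound
import Summits.ABC.ABC.Theorems.IsogenyGlueCongruenceEllipticGluingPrimeBoundStubImageDichotomyCore
import Summits.ABC.ABC.Theorems.IsogenyGlueCongruenceEllipticGluingPrimeBoundStubEndFieldDichotomy
import Literature.NumberTheory.EllipticCurves.MasserWustholzSurjectivity
import Literature.AlgebraicGeometry.Motives.AbelianVarietyEndGaloisDescent
import Literature.NumberTheory.GaloisRepresentations.AbsGaloisGroup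
import HarnessLib

/-!
# Crux U `EllipticGluingPrimeBound` (stmt-ABC-13919), line `SketchIdeator5` — the composition BY
# NAME: `U_simple` from the two residual slices, and U ⟺ (R_gen ∧ R_cm) modulo the shared inputs

Line `SketchIdeator5` (skeleton `Cruxes/EllipticGluingPrimeBound/Lines/SketchIdeator5.lean`, v5)
cuts the open core `U_simple` of the crux (height-free, dimension-polynomial torsion sharing with
ℚ-simple, geometrically `E`-free partners; `U ⟺ U_simple` modulo the route's shared apex inputs,
`ellipticGluingPrimeBound_iff_simple_of_cor44_of_gaudronRemond`, p120127) into two RESIDUALS: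

* R_gen (`stub_genericPartnerBound`): non-CM `W`, primes `ℓ ≥ 5` of surjective `ρ̄_{W,ℓ}`, and
  partners `A` over whose ENDOMORPHISM FIELD the congruence is FULL — every commutator
  automorphism of `W[ℓ]` (all of `SL₂(𝔽_ℓ)`) is `ρ̄_{W,ℓ}(σ)` for some `σ ∈ Γ_ℚ` fixing every
  geometric endomorphism of `A`;
* R_cm (`stub_cmCurvePartnerBound`): CM curves `W`.

This file lands the skeleton's composition as theorems with the residuals as HYPOTHESES:

* `simpleFreeTorsionBound_of_slices` — Masser–Wüstholz surjectivity + R_gen + R_cm ⟹ `U_simple`.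
  CM `W` → R_cm; non-CM `W` with `ℓ ≤ c·max(1,h_F W)^γ` or `ℓ < 5` → absorbed by the constant;
  otherwise `ρ̄_{W,ℓ}` is surjective and the LANDED endomorphism-field dichotomy
  (`stub_endFieldDichotomy` over `stub_imageDichotomyCore`, p125601/p125590) gives
  `ℓ ≤ 4 (dim A)² + 1 ≤ 5 X²` or a congruence full over `L_A` → R_gen.  Constants
  `κ = max 2 (max γ (max κ₁ κ₂))`, `C = 5 + max c 0 + max C₁ 0 + max C₂ 0`.
* `ellipticGluingPrimeBound_of_slices_of_masserWustholz` — MW + `FaltingsTate` + R_gen + R_cm ⟹ U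
  (through `ellipticGluingPrimeBound_of_simple_of_masserWustholz`, p120127).
* `ellipticGluingPrimeBound_of_slices_of_cor44_of_gaudronRemond` — the same on the route's
  shared apex facts {Mazur 1978 Cor. 4.4, Gaudron–Rémond pairs} in place of MW.
* `ellipticGluingPrimeBound_iff_slices_of_cor44_of_gaudronRemond` — modulo {Cor. 4.4, GR pairs,
  `FaltingsTate`} the crux is EQUIVALENT to R_gen ∧ R_cm (`→` unconditional:
  `genericPartnerBound_of_ellipticGluingPrimeBound` / `cmCurvePartnerBound_of_ellipticGluingPrimeBound`,
  …SlicesOfBound.lean).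

So after this line the crux U is, in the tree, exactly the conjunction of two named open cores:
the fixed-curve/uniform Frey–Mazur-type residual R_gen (full congruences over the endomorphism
field; its `dim A = 1` shadow is the fixed-curve polynomial Frey–Mazur problem) and the CM flank
R_cm (its `dim A = 1`, inert-`ℓ` shadow is Serre uniformity for CM sharing).  Conditional results
(hypotheses are named facts / open residuals); standard axioms; no definitions; no `sorry`.
-/

noncomputable section

-- `Summit.<Summit>.<Problem>` is the mandated summit-side namespace (CONVENTIONS §2); for the
-- single-conjunct summit `ABC` the two coincide, so the duplicate `ABC.ABC` is deliberate.
set_option linter.dupNamespace false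

namespace Summit.ABC.ABC.Theorems.GluingSlices

open CategoryTheory CategoryTheory.Limits AlgebraicGeometry
open Literature.AlgebraicGeometry.Motives
open Summit.ABC.ABC.Theses.IsogenyGlueCongruence
open Summit.ABC.ABC.Theorems.IsotypicMinkowski
open Literature.NumberTheory.EllipticCurves Literature.NumberTheory.DiophantineGeometry

/-- **`U_simple` from the slices** (the skeleton's composition, residuals as hypotheses):
Masser–Wüstholz surjectivity + R_gen + R_cm ⟹ `U_simple`.  CM `W` → R_cm; non-CM `W` and small
`ℓ` (`ℓ ≤ c · max(1,h)^γ` or `ℓ < 5`) → absorbed by the constant; otherwise `ρ̄_{W,ℓ}` is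
surjective and the landed dichotomy `stub_endFieldDichotomy` (with `stub_imageDichotomyCore`)
gives either `ℓ ≤ 4 dim² + 1 ≤ 5 X²` or a congruence that is full over the endomorphism field →
R_gen.  Constants: `κ = max 2 (max γ (max κ₁ κ₂))`, `C = 5 + max c 0 + max C₁ 0 + max C₂ 0`,
base `X = (dim A + 1) · max(1, h_F W) ≥ 1`.  Conditional result. -/
theorem simpleFreeTorsionBound_of_slices (hMW : masserWustholz_surjective_modEll)
    (hgen : ∃ κ C : ℝ, 0 ≤ κ ∧ ∀ (W : WeierstrassCurve ℚ) [W.IsElliptic] (E A : AbelianVariety.{0} ℚ)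
      (e : E.geomPoints ≃+ W.geomPoints),
      (∀ (σ : Field.absoluteGaloisGroup ℚ) (P : E.geomPoints), e (σ • P) = σ • e P) →
      (∀ f : E.baseChange (AlgebraicClosure ℚ) ⟶ A.baseChange (AlgebraicClosure ℚ), f = 0) →
      AbelianVariety.IsSimple A → ¬ W.HasCM →
      ∀ ℓ : ℕ, ℓ.Prime → 5 ≤ ℓ → W.HasSurjectiveModNGaloisRep ℓ →
      (∀ g ∈ commutator (Multiplicative (AddAut (W.geomTorsion ℓ))),
        ∃ σ : Field.absoluteGaloisGroup ℚ,
          (∀ r : A.baseChange (AlgebraicClosure ℚ) ⟶ A.baseChange (AlgebraicClosure ℚ),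
            A.galConj (AlgebraicClosure ℚ) (Field.absoluteGaloisGroup.toAlgEquiv ℚ σ) r = r) ∧
          W.galoisRepTorsion ℓ σ = g) →
      (∃ ι : W.geomTorsion ℓ →+ A.geomPoints, Function.Injective ι ∧
        ∀ (σ : Field.absoluteGaloisGroup ℚ) (P : W.geomTorsion ℓ), ι (σ • P) = σ • ι P) →
        (ℓ : ℝ) ≤ C * (((A.dim : ℝ) + 1) * max 1 W.stableFaltingsHeight) ^ κ)
    (hcm : ∃ κ C : ℝ, 0 ≤ κ ∧ ∀ (W : WeierstrassCurve ℚ) [W.IsElliptic] (E A : AbelianVariety.{0} ℚ)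
      (e : E.geomPoints ≃+ W.geomPoints),
      (∀ (σ : Field.absoluteGaloisGroup ℚ) (P : E.geomPoints), e (σ • P) = σ • e P) →
      (∀ f : E.baseChange (AlgebraicClosure ℚ) ⟶ A.baseChange (AlgebraicClosure ℚ), f = 0) →
      AbelianVariety.IsSimple A →
      ∀ ℓ : ℕ, ℓ.Prime → W.HasIrreducibleModPGaloisRep ℓ → W.HasCM →
      (∃ ι : W.geomTorsion ℓ →+ A.geomPoints, Function.Injective ι ∧
        ∀ (σ : Field.absoluteGaloisGroup ℚ) (P : W.geomTorsion ℓ), ι (σ • P) = σ • ι P) →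
        (ℓ : ℝ) ≤ C * (((A.dim : ℝ) + 1) * max 1 W.stableFaltingsHeight) ^ κ) :
    ∃ κ C : ℝ, 0 ≤ κ ∧ ∀ (W : WeierstrassCurve ℚ) [W.IsElliptic] (E A : AbelianVariety.{0} ℚ)
      (e : E.geomPoints ≃+ W.geomPoints),
      (∀ (σ : Field.absoluteGaloisGroup ℚ) (P : E.geomPoints), e (σ • P) = σ • e P) →
      (∀ f : E.baseChange (AlgebraicClosure ℚ) ⟶ A.baseChange (AlgebraicClosure ℚ), f = 0) →
      AbelianVariety.IsSimple A →
      ∀ ℓ : ℕ, ℓ.Prime → W.HasIrreducibleModPGaloisRep ℓ →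
      (∃ ι : W.geomTorsion ℓ →+ A.geomPoints, Function.Injective ι ∧
        ∀ (σ : Field.absoluteGaloisGroup ℚ) (P : W.geomTorsion ℓ), ι (σ • P) = σ • ι P) →
        (ℓ : ℝ) ≤ C * (((A.dim : ℝ) + 1) * max 1 W.stableFaltingsHeight) ^ κ := by
  obtain ⟨c, γ, hγ, hMW⟩ := hMW
  obtain ⟨κ₁, C₁, hκ₁, hG⟩ := hgen
  obtain ⟨κ₂, C₂, hκ₂, hC⟩ := hcm
  have hD := stub_endFieldDichotomy stub_imageDichotomyCore
  refine ⟨max 2 (max γ (max κ₁ κ₂)), 5 + max c 0 + max C₁ 0 + max C₂ 0,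
    zero_le_two.trans (le_max_left _ _), ?_⟩
  intro W _ E A e he hfree hsimp ℓ hℓ hirr hι
  set κ : ℝ := max 2 (max γ (max κ₁ κ₂)) with hκdef
  set K : ℝ := 5 + max c 0 + max C₁ 0 + max C₂ 0 with hKdef
  set X : ℝ := ((A.dim : ℝ) + 1) * max 1 W.stableFaltingsHeight with hX
  have hh : (1 : ℝ) ≤ max 1 W.stableFaltingsHeight := le_max_left _ _
  have hm0 : (0 : ℝ) ≤ max 1 W.stableFaltingsHeight := zero_le_one.trans hh
  have hdim1 : (1 : ℝ) ≤ (A.dim : ℝ) + 1 := by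
    have : (0 : ℝ) ≤ (A.dim : ℝ) := Nat.cast_nonneg _
    linarith
  have hX1 : 1 ≤ X := by rw [hX]; nlinarith
  have hX0 : 0 ≤ X := zero_le_one.trans hX1
  have hmX : max 1 W.stableFaltingsHeight ≤ X := by
    rw [hX]
    calc max 1 W.stableFaltingsHeight = 1 * max 1 W.stableFaltingsHeight := (one_mul _).symm
      _ ≤ ((A.dim : ℝ) + 1) * max 1 W.stableFaltingsHeight := mul_le_mul_of_nonneg_right hdim1 hm0
  have hκ2 : 2 ≤ κ := le_max_left _ _
  have hκ0 : 0 ≤ κ := zero_le_two.trans hκ2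
  have hγκ : γ ≤ κ := (le_max_left _ _).trans (le_max_right _ _)
  have hκ₁κ : κ₁ ≤ κ := ((le_max_left _ _).trans (le_max_right _ _)).trans (le_max_right _ _)
  have hκ₂κ : κ₂ ≤ κ := ((le_max_right _ _).trans (le_max_right _ _)).trans (le_max_right _ _)
  have hXpow1 : 1 ≤ X ^ κ := Real.one_le_rpow hX1 hκ0
  have hXpow0 : 0 ≤ X ^ κ := zero_le_one.trans hXpow1
  have hc0 : (0 : ℝ) ≤ max c 0 := le_max_right _ _
  have hC₁0 : (0 : ℝ) ≤ max C₁ 0 := le_max_right _ _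
  have hC₂0 : (0 : ℝ) ≤ max C₂ 0 := le_max_right _ _
  have hK5 : (5 : ℝ) ≤ K := by rw [hKdef]; linarith
  have hK0 : (0 : ℝ) ≤ K := by linarith
  -- absorbing a partial bound `ℓ ≤ K' * X ^ κ'` with `K' ≤ K`, `κ' ≤ κ`
  have key : ∀ K' κ' : ℝ, K' ≤ K → κ' ≤ κ → (ℓ : ℝ) ≤ K' * X ^ κ' → (ℓ : ℝ) ≤ K * X ^ κ := by
    intro K' κ' hK' hκ' hb
    have hK'0 : 0 ≤ max K' 0 := le_max_right _ _
    calc (ℓ : ℝ) ≤ K' * X ^ κ' := hb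
      _ ≤ max K' 0 * X ^ κ' := mul_le_mul_of_nonneg_right (le_max_left _ _) (Real.rpow_nonneg hX0 _)
      _ ≤ max K' 0 * X ^ κ :=
          mul_le_mul_of_nonneg_left (Real.rpow_le_rpow_of_exponent_le hX1 hκ') hK'0
      _ ≤ K * X ^ κ := mul_le_mul_of_nonneg_right (max_le hK' hK0) hXpow0
  -- constants are absorbed: `ℓ ≤ K` suffices whenever `ℓ ≤ 5`
  have small : (ℓ : ℝ) ≤ 5 → (ℓ : ℝ) ≤ K * X ^ κ := by
    intro h5
    calc (ℓ : ℝ) ≤ K := h5.trans hK5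
      _ = K * 1 := (mul_one K).symm
      _ ≤ K * X ^ κ := mul_le_mul_of_nonneg_left hXpow1 hK0
  by_cases hcm : W.HasCM
  · -- CM flank
    have hb := hC W E A e he hfree hsimp ℓ hℓ hirr hcm hι
    refine key C₂ κ₂ ?_ hκ₂κ hb
    rw [hKdef]
    have : C₂ ≤ max C₂ 0 := le_max_left _ _
    linarith
  · by_cases hsm : (ℓ : ℝ) ≤ c * (max 1 W.stableFaltingsHeight) ^ γ
    · -- below the surjectivity threshold
      have hb : (ℓ : ℝ) ≤ max c 0 * X ^ γ :=
        calc (ℓ : ℝ) ≤ c * (max 1 W.stableFaltingsHeight) ^ γ := hsm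
          _ ≤ max c 0 * (max 1 W.stableFaltingsHeight) ^ γ :=
              mul_le_mul_of_nonneg_right (le_max_left _ _) (Real.rpow_nonneg hm0 _)
          _ ≤ max c 0 * X ^ γ :=
              mul_le_mul_of_nonneg_left (Real.rpow_le_rpow hm0 hmX hγ) hc0
      refine key (max c 0) γ ?_ hγκ hb
      rw [hKdef]; linarith
    · have hsurj : W.HasSurjectiveModNGaloisRep ℓ := hMW W hcm ℓ hℓ (lt_of_not_ge hsm)
      by_cases h5 : ℓ < 5
      · exact small (by exact_mod_cast h5.le)
      · have h5' : 5 ≤ ℓ := not_lt.mp h5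
        rcases hD W A ℓ hℓ h5' hsurj with hb | hfull
        · -- the dichotomy's bound: `ℓ ≤ 4 dim² + 1 ≤ 5 X ^ 2 ≤ 5 X ^ κ`
          have hbR : (ℓ : ℝ) ≤ 4 * (A.dim : ℝ) ^ 2 + 1 := by exact_mod_cast hb
          have hd0 : (0 : ℝ) ≤ (A.dim : ℝ) := Nat.cast_nonneg _
          have h1 : 4 * (A.dim : ℝ) ^ 2 + 1 ≤ 5 * X ^ (2 : ℝ) := by
            rw [Real.rpow_two, hX]
            nlinarith [hh, hm0, hd0, sq_nonneg ((A.dim : ℝ) + 1),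
              mul_le_mul_of_nonneg_left hh (sq_nonneg ((A.dim : ℝ) + 1))]
          refine key 5 2 ?_ hκ2 (hbR.trans h1)
          rw [hKdef]; linarith
        · -- the congruence is full over `L_A`: the generic residual
          have hb := hG W E A e he hfree hsimp hcm ℓ hℓ h5' hsurj hfull hι
          refine key C₁ κ₁ ?_ hκ₁κ hb
          rw [hKdef]
          have : C₁ ≤ max C₁ 0 := le_max_left _ _
          linarith

/-- **MW + `FaltingsTate` + R_gen + R_cm ⟹ U**: the crux from the two residual slices of line
`SketchIdeator5`, through `simpleFreeTorsionBound_of_slices` and the landed reduction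
`ellipticGluingPrimeBound_of_simple_of_masserWustholz` (p120127).  Conditional result. -/
theorem ellipticGluingPrimeBound_of_slices_of_masserWustholz :
    masserWustholz_surjective_modEll → FaltingsTate →
    (∃ κ C : ℝ, 0 ≤ κ ∧ ∀ (W : WeierstrassCurve ℚ) [W.IsElliptic] (E A : AbelianVariety.{0} ℚ)
      (e : E.geomPoints ≃+ W.geomPoints),
      (∀ (σ : Field.absoluteGaloisGroup ℚ) (P : E.geomPoints), e (σ • P) = σ • e P) →
      (∀ f : E.baseChange (AlgebraicClosure ℚ) ⟶ A.baseChange (AlgebraicClosure ℚ), f = 0) →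
      AbelianVariety.IsSimple A → ¬ W.HasCM →
      ∀ ℓ : ℕ, ℓ.Prime → 5 ≤ ℓ → W.HasSurjectiveModNGaloisRep ℓ →
      (∀ g ∈ commutator (Multiplicative (AddAut (W.geomTorsion ℓ))),
        ∃ σ : Field.absoluteGaloisGroup ℚ,
          (∀ r : A.baseChange (AlgebraicClosure ℚ) ⟶ A.baseChange (AlgebraicClosure ℚ),
            A.galConj (AlgebraicClosure ℚ) (Field.absoluteGaloisGroup.toAlgEquiv ℚ σ) r = r) ∧
          W.galoisRepTorsion ℓ σ = g) →
      (∃ ι : W.geomTorsion ℓ →+ A.geomPoints, Function.Injective ι ∧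
        ∀ (σ : Field.absoluteGaloisGroup ℚ) (P : W.geomTorsion ℓ), ι (σ • P) = σ • ι P) →
        (ℓ : ℝ) ≤ C * (((A.dim : ℝ) + 1) * max 1 W.stableFaltingsHeight) ^ κ) →
    (∃ κ C : ℝ, 0 ≤ κ ∧ ∀ (W : WeierstrassCurve ℚ) [W.IsElliptic] (E A : AbelianVariety.{0} ℚ)
      (e : E.geomPoints ≃+ W.geomPoints),
      (∀ (σ : Field.absoluteGaloisGroup ℚ) (P : E.geomPoints), e (σ • P) = σ • e P) →
      (∀ f : E.baseChange (AlgebraicClosure ℚ) ⟶ A.baseChange (AlgebraicClosure ℚ), f = 0) →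
      AbelianVariety.IsSimple A →
      ∀ ℓ : ℕ, ℓ.Prime → W.HasIrreducibleModPGaloisRep ℓ → W.HasCM →
      (∃ ι : W.geomTorsion ℓ →+ A.geomPoints, Function.Injective ι ∧
        ∀ (σ : Field.absoluteGaloisGroup ℚ) (P : W.geomTorsion ℓ), ι (σ • P) = σ • ι P) →
        (ℓ : ℝ) ≤ C * (((A.dim : ℝ) + 1) * max 1 W.stableFaltingsHeight) ^ κ) →
    EllipticGluingPrimeBound :=
  fun hMW hFal hgen hcm ↦ ellipticGluingPrimeBound_of_simple_of_masserWustholz hMW hFal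
    (simpleFreeTorsionBound_of_slices hMW hgen hcm)

/-- **Cor. 4.4 + GR pairs + `FaltingsTate` + R_gen + R_cm ⟹ U**: the same composition re-based
on the route's shared apex facts — Mazur 1978 Cor. 4.4 gives Mazur's isogeny theorem
(`mazur_isogeny_irreducible_holds_of`), which with the Gaudron–Rémond pair theorem gives
Masser–Wüstholz surjectivity
(`MasserWustholz1993.masserWustholz_surjective_modEll_of_mazur_of_gaudronRemond`).
Conditional result. -/
theorem ellipticGluingPrimeBound_of_slices_of_cor44_of_gaudronRemond :
    Mazur1978.cor44_valuation_j_le_one → GaudronRemond2023_torsionHom_ellipticPair → FaltingsTate →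
    (∃ κ C : ℝ, 0 ≤ κ ∧ ∀ (W : WeierstrassCurve ℚ) [W.IsElliptic] (E A : AbelianVariety.{0} ℚ)
      (e : E.geomPoints ≃+ W.geomPoints),
      (∀ (σ : Field.absoluteGaloisGroup ℚ) (P : E.geomPoints), e (σ • P) = σ • e P) →
      (∀ f : E.baseChange (AlgebraicClosure ℚ) ⟶ A.baseChange (AlgebraicClosure ℚ), f = 0) →
      AbelianVariety.IsSimple A → ¬ W.HasCM →
      ∀ ℓ : ℕ, ℓ.Prime → 5 ≤ ℓ → W.HasSurjectiveModNGaloisRep ℓ →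
      (∀ g ∈ commutator (Multiplicative (AddAut (W.geomTorsion ℓ))),
        ∃ σ : Field.absoluteGaloisGroup ℚ,
          (∀ r : A.baseChange (AlgebraicClosure ℚ) ⟶ A.baseChange (AlgebraicClosure ℚ),
            A.galConj (AlgebraicClosure ℚ) (Field.absoluteGaloisGroup.toAlgEquiv ℚ σ) r = r) ∧
          W.galoisRepTorsion ℓ σ = g) →
      (∃ ι : W.geomTorsion ℓ →+ A.geomPoints, Function.Injective ι ∧
        ∀ (σ : Field.absoluteGaloisGroup ℚ) (P : W.geomTorsion ℓ), ι (σ • P) = σ • ι P) →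
        (ℓ : ℝ) ≤ C * (((A.dim : ℝ) + 1) * max 1 W.stableFaltingsHeight) ^ κ) →
    (∃ κ C : ℝ, 0 ≤ κ ∧ ∀ (W : WeierstrassCurve ℚ) [W.IsElliptic] (E A : AbelianVariety.{0} ℚ)
      (e : E.geomPoints ≃+ W.geomPoints),
      (∀ (σ : Field.absoluteGaloisGroup ℚ) (P : E.geomPoints), e (σ • P) = σ • e P) →
      (∀ f : E.baseChange (AlgebraicClosure ℚ) ⟶ A.baseChange (AlgebraicClosure ℚ), f = 0) →
      AbelianVariety.IsSimple A →
      ∀ ℓ : ℕ, ℓ.Prime → W.HasIrreducibleModPGaloisRep ℓ → W.HasCM →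
      (∃ ι : W.geomTorsion ℓ →+ A.geomPoints, Function.Injective ι ∧
        ∀ (σ : Field.absoluteGaloisGroup ℚ) (P : W.geomTorsion ℓ), ι (σ • P) = σ • ι P) →
        (ℓ : ℝ) ≤ C * (((A.dim : ℝ) + 1) * max 1 W.stableFaltingsHeight) ^ κ) →
    EllipticGluingPrimeBound :=
  fun h44 hGR hFal hgen hcm ↦ ellipticGluingPrimeBound_of_slices_of_masserWustholz
    (MasserWustholz1993.masserWustholz_surjective_modEll_of_mazur_of_gaudronRemond
      (mazur_isogeny_irreducible_holds_of h44 Mazur1978.prop51_exponent_classes_of_additive_holds)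
      hGR) hFal hgen hcm

/-- **U ⟺ (R_gen ∧ R_cm) modulo the shared inputs** {Mazur Cor. 4.4, GR pairs, `FaltingsTate`}:
`→` is unconditional (`genericPartnerBound_of_simpleFreeTorsionBound` /
`cmCurvePartnerBound_of_simpleFreeTorsionBound`, p126295, over `U ⟹ U_simple`, p117529), `←` is
`ellipticGluingPrimeBound_of_slices_of_cor44_of_gaudronRemond`.  After line `SketchIdeator5` the
crux is thus, in the tree, exactly the conjunction of its two residual open cores. -/
theorem ellipticGluingPrimeBound_iff_slices_of_cor44_of_gaudronRemond :
    Mazur1978.cor44_valuation_j_le_one → GaudronRemond2023_torsionHom_ellipticPair → FaltingsTate →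
    (EllipticGluingPrimeBound ↔
      (∃ κ C : ℝ, 0 ≤ κ ∧ ∀ (W : WeierstrassCurve ℚ) [W.IsElliptic] (E A : AbelianVariety.{0} ℚ)
      (e : E.geomPoints ≃+ W.geomPoints),
      (∀ (σ : Field.absoluteGaloisGroup ℚ) (P : E.geomPoints), e (σ • P) = σ • e P) →
      (∀ f : E.baseChange (AlgebraicClosure ℚ) ⟶ A.baseChange (AlgebraicClosure ℚ), f = 0) →
      AbelianVariety.IsSimple A → ¬ W.HasCM →
      ∀ ℓ : ℕ, ℓ.Prime → 5 ≤ ℓ → W.HasSurjectiveModNGaloisRep ℓ →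
      (∀ g ∈ commutator (Multiplicative (AddAut (W.geomTorsion ℓ))),
        ∃ σ : Field.absoluteGaloisGroup ℚ,
          (∀ r : A.baseChange (AlgebraicClosure ℚ) ⟶ A.baseChange (AlgebraicClosure ℚ),
            A.galConj (AlgebraicClosure ℚ) (Field.absoluteGaloisGroup.toAlgEquiv ℚ σ) r = r) ∧
          W.galoisRepTorsion ℓ σ = g) →
      (∃ ι : W.geomTorsion ℓ →+ A.geomPoints, Function.Injective ι ∧
        ∀ (σ : Field.absoluteGaloisGroup ℚ) (P : W.geomTorsion ℓ), ι (σ • P) = σ • ι P) →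
        (ℓ : ℝ) ≤ C * (((A.dim : ℝ) + 1) * max 1 W.stableFaltingsHeight) ^ κ) ∧
      (∃ κ C : ℝ, 0 ≤ κ ∧ ∀ (W : WeierstrassCurve ℚ) [W.IsElliptic] (E A : AbelianVariety.{0} ℚ)
      (e : E.geomPoints ≃+ W.geomPoints),
      (∀ (σ : Field.absoluteGaloisGroup ℚ) (P : E.geomPoints), e (σ • P) = σ • e P) →
      (∀ f : E.baseChange (AlgebraicClosure ℚ) ⟶ A.baseChange (AlgebraicClosure ℚ), f = 0) →
      AbelianVariety.IsSimple A →
      ∀ ℓ : ℕ, ℓ.Prime → W.HasIrreducibleModPGaloisRep ℓ → W.HasCM →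
      (∃ ι : W.geomTorsion ℓ →+ A.geomPoints, Function.Injective ι ∧
        ∀ (σ : Field.absoluteGaloisGroup ℚ) (P : W.geomTorsion ℓ), ι (σ • P) = σ • ι P) →
        (ℓ : ℝ) ≤ C * (((A.dim : ℝ) + 1) * max 1 W.stableFaltingsHeight) ^ κ)) :=
  fun h44 hGR hFal ↦ ⟨fun hU ↦
      ⟨genericPartnerBound_of_simpleFreeTorsionBound (simpleFreeTorsionBound_of_ellipticGluingPrimeBound hU),
        cmCurvePartnerBound_of_simpleFreeTorsionBound (simpleFreeTorsionBound_of_ellipticGluingPrimeBound hU)⟩,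
    fun h ↦ ellipticGluingPrimeBound_of_slices_of_cor44_of_gaudronRemond h44 hGR hFal h.1 h.2⟩

end Summit.ABC.ABC.Theorems.GluingSlices

end
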